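import Literature.NumberTheory.EllipticCurves.SkinnerUrban2014.PAdicUnitPeriodRatioProofs
import HarnessLib

/-!
# Route `PrintX6`, crux `EisensteinHalfFiveLeRest` (stmt-BirchSwinnertonDyer-21116), line `kim-deficit`:
# the Manin binder `p ∤ c_D` of the Kim engine DISCHARGED — a modular parametrisation datum with Manin
# constant prime to `p` for EVERY globally minimal curve with `E[p]` irreducible (Mazur 1978 Cor. 4.1 /
# Abbes–Ullmo 1996 Thm. A on the optimal curve, transported along a prime-to-`p` isogeny)

HONEST FRAMING (cell `bsd-print-x6`, run/shared/lean/pub/bsd-print-x6/; D-0152 / W-71). Helper of the LEAD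
seat `x6-p2` for stub 2 (`stub_missingLowerBoundAt_of_levelCertificate_X6`, the ENGINE) of the registered line
`Cruxes/EisensteinHalfFiveLeRest/Lines/kim_deficit.lean`. THEOREMS ONLY (no definition, no named fact, no
`sorry`); nothing about any particular curve is asserted; no summit statement is proved by this seat; BSD is
not proved by any of this.

## Why this file exists

Every consumer of C.-H. Kim's structure theorem in the tree (the named facts
`Kim2026.rankZero_le_padicValNat_sha_of_kuriharaNumber_ne_zero[_of_localTorsionTrivial]`, and the per-pair
theorems built on them, `X4.missingLowerBoundAt_rankZero_of_kimLower`, `X6RankZero.bsdp_of_kimLower_of_prop48`,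
the X6/X7 Kurihara records …) carries the DATA BINDERS `(D : ModularParametrizationData W N)
(hc : ¬ (p : ℤ) ∣ D.maninConstant)` — Kim's hypothesis (ii) "the Manin constant is prime to `p`" — and
the period transfer `Ω(W) = u · Ω⁺_{D.f}`, `|u|_p = 1`. The period transfer is already a THEOREM over
Mazur's corollary (`SkinnerUrban2014.realPeriodRat_eq_unit_mul_plusPeriod_of_mazur`, Greenberg–Vatsal 2000
Rem. 3.4); the Manin binder was not: the tree's Manin facts (`mazur_not_dvd_maninConstant_of_odd`,
`abbesUllmo_not_dvd_maninConstant_of_not_dvd_level`) speak about the LATTICE-OPTIMAL datum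
(`Λ_{E₀} = c₀ Λ_f`, the strong Weil curve), not about an arbitrary member `W` of the isogeny class.
Stub 2 of `kim-deficit` quantifies over `W` and a newform only, so its engine needs, for every `W` with
`ρ̄_{E,p}` onto, SOME datum of `W` with `p ∤ c_D`. This file proves exactly that, by the bookkeeping of
Greenberg–Vatsal's Remark 3.4 already formalised for periods in
`Literature/…/SkinnerUrban2014/PAdicUnitPeriodRatioProofs.lean`:

* §1 `exists_datum_of_admissible` — every non-zero ADMISSIBLE constant `c₁` (`c₁ Λ_f ⊆ Λ_W`) is the Manin
  constant of a datum of `W` with the same newform (degree clause = the tree's PROVED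
  `exists_modularDegree_holds`, transported along `ℂ/Λ_W ≃ E(ℂ)`); adapted from
  `Theorems/SemiOrdinaryEisensteinDescentWildKolyvaginUpperAtThreeTowerFreeManinPrimitive.lean` §1 (seat
  bsd-wall-soed-p2-w2), restated here to avoid importing that route's chain.
* §2 `exists_admissible_not_dvd_of_irreducible` — if `E[p]` is irreducible (`p` any prime) and the Manin
  constant `c₀` of the lattice-optimal datum on the globally minimal model `W₀` of the strong Weil curve is
  prime to `p`, then `W` has an admissible constant prime to `p`: with `ψ : W → W₀` a `ℚ`-isogeny of degree
  `d` prime to `p` (`exists_isogeny_not_dvd_degree_of_irreducible`), `ψ` acts on Néron lattices as `z ↦ r z`,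
  `r Λ_W ⊆ Λ_{W₀}` of index `d` (`exists_rat_mulLeft_lattice_le_of_isogeny`), so `(d/r) Λ_{W₀} ⊆ Λ_W` with
  `r, d/r ∈ ℤ` (`integral_neronScaling_of_isGloballyMinimal_holds`), hence `(d/r)·c₀ · Λ_f ⊆ (d/r) Λ_{W₀} ⊆ Λ_W`
  and `p ∤ (d/r)·c₀`.
* §3 `exists_datum_not_dvd_maninConstant_of_irreducible` (Manin hypothesis in the optimal-datum form of
  `SkinnerUrban2014.exists_unit_mul_plusPeriod_of_irreducible`), and its two named-fact instances
  `…_of_mazur` (odd `p`, `p² ∤ N`; Mazur 1978 Cor. 4.1) and `…_of_abbesUllmo` (`p ∤ N`; Abbes–Ullmo 1996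
  Thm. A).
* §4 `exists_kimDatum_of_good_of_mazur` — the shape the Kim engine consumes: at a GOOD odd prime `p` with
  `E[p]` irreducible, for the newform `f` of `W` at any level `N` (`p ∤ N` by Atkin–Lehner/Carayol,
  `not_dvd_level_of_hasGoodReductionAtPrime`), a datum `D` with `D.f = f`, `p ∤ c_D` AND the period unit
  `Ω(W) = u · Ω⁺_{D.f}`, `|u|_p = 1` — both from the ONE named fact `mazur_not_dvd_maninConstant_of_odd`
  (route item `PrintX6.InputMazurManinOdd`, stmt-BirchSwinnertonDyer-19383).

Everything is CONDITIONAL on the Manin fact taken as a hypothesis BY NAME (conditional-result); Mazur's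
Cor. 4.1 (Néron model of `J₀(N)` over `ℤ_(p)`) is not proved in the tree.

References: B. Mazur, Invent. Math. 44 (1978) Cor. 4.1 [Mazur1978]; A. Abbes, E. Ullmo, Compositio Math. 103
(1996) Thm. A [AbbesUllmo1996]; R. Greenberg, V. Vatsal, Invent. Math. 142 (2000) §3 Rem. 3.4
[GreenbergVatsal2000]; B. Edixhoven, Progr. Math. 89 (1991) Prop. 2 and §1 [EdixhovenManin1991]; J. H.
Silverman, AEC, III.4.11, VI.4.1 (b), VI.5.1 [SilvermanAEC2009]; H. Farkas, I. Kra, Riemann Surfaces, Prop.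
I.1.6 [FarkasKra1992]; C.-H. Kim, Amer. J. Math. 148 (2026) §1.3.5 [Kim2022StructureSelmer].
-/

set_option autoImplicit false
-- the landed namespace `Summit.BirchSwinnertonDyer.BirchSwinnertonDyer.Theorems` (summit = problem) trips the linter
set_option linter.dupNamespace false

noncomputable section

open scoped Classical MatrixGroups ModularForm

open CongruenceSubgroup WeierstrassCurve Literature.NumberTheory.EllipticCurves
  Literature.NumberTheory.EllipticCurves.ModularForms
  Literature.NumberTheory.EllipticCurves.SkinnerUrban2014

namespace Summit.BirchSwinnertonDyer.BirchSwinnertonDyer.Theorems.PrintX6.KimDeficit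

/-! ## §1 A datum for every non-zero admissible constant -/

/-- **Every non-zero admissible constant is the Manin constant of a datum with the same newform.** For a
modular parametrisation datum `Dt` of `W` at level `N` and an integer `c₁ ≠ 0` with `c₁ Λ_f ⊆ Λ_W`
(`Λ_f = periodLattice Dt.f`, `Λ_W = Dt.L.lattice`), there is a datum `Dt'` of `W` at level `N` with
`Dt'.f = Dt.f` and Manin constant `c₁`: the degree clause is the tree's PROVED `exists_modularDegree_holds`
(degree of `Γ₀(N)τ ↦ c₁·2πi∫f (mod Λ_W)`) transported along the datum's own uniformisation `ℂ/Λ_W ≃ E(ℂ)`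
(`finite_setOf_card_fiberOrbits_ne_iff`). [cite: FarkasKra1992, Prop. I.1.6]
[cite: EdixhovenManin1991, §1] -/
theorem exists_datum_of_admissible {W : WeierstrassCurve ℚ} {N : ℕ} [NeZero N]
    (Dt : ModularParametrizationData W N) {c₁ : ℤ} (hc₁ : c₁ ≠ 0)
    (hadm : ∀ z ∈ periodLattice Dt.f, (c₁ : ℂ) * z ∈ Dt.L.lattice) :
    ∃ Dt' : ModularParametrizationData W N, Dt'.f = Dt.f ∧ Dt'.maninConstant = c₁ := by
  -- adapted from Theorems/SemiOrdinaryEisensteinDescentWildKolyvaginUpperAtThreeTowerFreeManinPrimitive.lean §1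
  obtain ⟨d, hd, hfin⟩ := exists_modularDegree_holds Dt.isNewformOf.1.ne_zero (L := Dt.L) (c := (c₁ : ℂ))
    (Int.cast_ne_zero.mpr hc₁) hadm
  have hker' : Dt.L.lattice.toAddSubgroup = Dt.uniformize.ker :=
    SetLike.coe_injective (by rw [Submodule.coe_toAddSubgroup, Dt.ker_uniformize])
  let e : ℂ ⧸ Dt.L.lattice.toAddSubgroup ≃+ (W.baseChange ℂ).toAffine.Point :=
    QuotientAddGroup.liftEquiv Dt.L.lattice.toAddSubgroup Dt.uniformize_surjective hker'
  have he : ∀ x : ℂ, e.toEquiv (x : ℂ ⧸ Dt.L.lattice.toAddSubgroup) = Dt.uniformize x := fun _ ↦ rfl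
  have key := (finite_setOf_card_fiberOrbits_ne_iff e.toEquiv
    (fun τ : UpperHalfPlane ↦
      (((c₁ : ℂ) * eichlerIntegral Dt.f τ : ℂ) : ℂ ⧸ Dt.L.lattice.toAddSubgroup)) d).mpr hfin
  simp only [he] at key
  exact ⟨{ f := Dt.f
           isNewformOf := Dt.isNewformOf
           L := Dt.L
           isNeronLattice := Dt.isNeronLattice
           uniformize := Dt.uniformize
           ker_uniformize := Dt.ker_uniformize
           uniformize_surjective := Dt.uniformize_surjective
           uniformize_spec := Dt.uniformize_spec
           c := c₁
           smul_periodLattice_le := hadm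
           deg := d
           deg_pos := hd
           deg_spec := key }, rfl, rfl⟩

/-! ## §2 An admissible constant prime to `p` along a prime-to-`p` isogeny -/

/-- **If `E[p]` is irreducible and the optimal curve's Manin constant is prime to `p`, some admissible
constant of `W` is prime to `p`.** Let `W/ℚ` be globally minimal with `E[p]` irreducible, `D` a datum of `W`
at level `N` (newform `f = D.f`, Néron lattice `Λ_W = D.L.lattice`), and assume (`hc`) that the Manin
constant of every lattice-optimal datum with newform `f` on a globally minimal model (`Λ_{W₀} = c₀ Λ_f`: the
strong Weil curve) is prime to `p`. Then there is `c₁ ∈ ℤ`, `p ∤ c₁`, with `c₁ Λ_f ⊆ Λ_W`. Proof: the optimal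
datum `D₀` on a globally minimal `W₀ ~ W` (`exists_optimalDatum_of_edixhoven`, Edixhoven's Prop. 2 being the
tree theorem `edixhoven_int_of_neronLattice_eq_smul_periodLattice_holds`); an isogeny `ψ : W → W₀` of degree
`d` prime to `p` (`exists_isogeny_not_dvd_degree_of_irreducible`); `ψ` is `z ↦ rz` on lattices with
`[Λ_{W₀} : rΛ_W] = d` (`exists_rat_mulLeft_lattice_le_of_isogeny`), so `d Λ_{W₀} ⊆ r Λ_W`, and `r`, `d/r` are
integers (`integral_neronScaling_of_isGloballyMinimal_holds`); `c₁ := (d/r)·c₀`.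
[cite: GreenbergVatsal2000, §3, Remark 3.4] [cite: SilvermanAEC2009, Cor. III.4.11 and Thm. VI.4.1(b)]
[cite: EdixhovenManin1991, Prop. 2] -/
theorem exists_admissible_not_dvd_of_irreducible (W : WeierstrassCurve ℚ) [W.IsElliptic]
    [W.IsGloballyMinimal] (p : ℕ) [Fact p.Prime] (hirr : W.HasIrreducibleModPGaloisRep p)
    {N : ℕ} [NeZero N] (D : ModularParametrizationData W N)
    (hc : ∀ (W₀ : WeierstrassCurve ℚ) [W₀.IsElliptic] [W₀.IsGloballyMinimal]
      (D₀ : ModularParametrizationData W₀ N), D₀.f = D.f →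
      (∀ z ∈ D₀.L.lattice, ∃ w ∈ periodLattice D₀.f, z = D₀.c * w) → ¬ (p : ℤ) ∣ D₀.maninConstant) :
    ∃ c₁ : ℤ, ¬ (p : ℤ) ∣ c₁ ∧ ∀ z ∈ periodLattice D.f, (c₁ : ℂ) * z ∈ D.L.lattice := by
  have hpP : p.Prime := Fact.out
  have hpZ : Prime (p : ℤ) := Nat.prime_iff_prime_int.mp hpP
  -- the optimal datum on a globally minimal model of the strong Weil curve
  obtain ⟨W₀, hW₀, hW₀', D₀, hf₀, hiso, hopt, -⟩ :=
    D.exists_optimalDatum_of_edixhoven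
      (fun hf' hL' q hq hq' ↦ edixhoven_int_of_neronLattice_eq_smul_periodLattice_holds hf' hL' q hq hq')
  have hc₀ : ¬ (p : ℤ) ∣ D₀.c := hc W₀ D₀ hf₀ hopt
  -- an isogeny `W → W₀` of degree prime to `p`
  obtain ⟨ψ, hψ⟩ := exists_isogeny_not_dvd_degree_of_irreducible (W := W) (W' := W₀)
    (Nat.cast_ne_zero.mpr hpP.ne_zero) hirr hiso
  -- the lattice step: `rΛ_W ⊆ Λ_{W₀}` of index `d`, hence `(d/r) Λ_{W₀} ⊆ Λ_W` with `r, d/r ∈ ℤ`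
  obtain ⟨r, hr0, hle, hidx⟩ :=
    exists_rat_mulLeft_lattice_le_of_isogeny W W₀ D.isNeronLattice D₀.isNeronLattice ψ
  set d : ℕ := ψ.degree with hd
  have hr0' : (r : ℚ) ≠ 0 := by
    rintro rfl
    exact hr0 (by push_cast; rfl)
  have hmem : ∀ z ∈ D.L.lattice, ((r : ℚ) : ℂ) * z ∈ D₀.L.lattice := fun z hz ↦
    hle (PeriodPair.mul_mem_mulLeft_lattice.mpr hz)
  obtain ⟨q, hq⟩ := integral_neronScaling_of_isGloballyMinimal_holds W W₀ D.L D₀.L D.isNeronLattice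
    D₀.isNeronLattice r hmem
  have hdmem : ∀ z ∈ D₀.L.lattice, ((d / r : ℚ) : ℂ) * z ∈ D.L.lattice := by
    intro z hz
    have h1 : d • z ∈ (D.L.mulLeft (r : ℂ) hr0).lattice := by
      have h2 := AddSubgroup.nsmul_relIndex_mem (D.L.mulLeft (r : ℂ) hr0).lattice.toAddSubgroup
        (K := D₀.L.lattice.toAddSubgroup) (g := z) hz
      rw [hidx] at h2
      exact h2
    rw [PeriodPair.mem_mulLeft_lattice, nsmul_eq_mul] at h1
    have e : ((d / r : ℚ) : ℂ) * z = ((r : ℚ) : ℂ)⁻¹ * ((d : ℂ) * z) := by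
      push_cast
      ring
    rw [e]
    exact h1
  obtain ⟨q', hq'⟩ := integral_neronScaling_of_isGloballyMinimal_holds W₀ W D₀.L D.L
    D₀.isNeronLattice D.isNeronLattice (d / r) hdmem
  have hqq' : q * q' = d := by
    have h : (q : ℚ) * q' = d := by
      rw [hq, hq']
      field_simp
    exact_mod_cast h
  -- `c₁ = (d/r) · c₀`
  refine ⟨q' * D₀.c, fun h ↦ ?_, fun z hz ↦ ?_⟩
  · rcases hpZ.dvd_or_dvd h with h1 | h2
    · exact hψ (Int.natCast_dvd_natCast.mp (hqq' ▸ h1.mul_left q))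
    · exact hc₀ h2
  · have hz' : z ∈ periodLattice D₀.f := by rw [hf₀]; exact hz
    have h1 : (D₀.c : ℂ) * z ∈ D₀.L.lattice := D₀.smul_periodLattice_le z hz'
    have h2 := hdmem _ h1
    rw [← hq'] at h2
    convert h2 using 1
    push_cast
    ring

/-! ## §3 A datum of `W` with Manin constant prime to `p` -/

/-- **A modular parametrisation datum with `p ∤ c_D` for every globally minimal curve with `E[p]`
irreducible, modulo the Manin constant of the optimal curve.** For `W/ℚ` globally minimal elliptic, `p` a
prime with `E[p]` irreducible, `f ∈ S₂(Γ₀(N))` the newform of `W`, and (`hc`) `p ∤ c₀` for every lattice-optimal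
datum with newform `f` on a globally minimal model: there is a datum `D` of `W` at level `N` with `D.f = f`
and `p ∤ D.maninConstant` (a datum of `W` exists from `IsNewformOf W f` alone,
`nonempty_modularParametrizationData_of_isNewformOf`; then §2 and §1). This is the datum-level companion of
`SkinnerUrban2014.exists_unit_mul_plusPeriod_of_irreducible` (same hypothesis `hc`, which there yields the
period unit). [cite: GreenbergVatsal2000, §3, Remark 3.4] [cite: EdixhovenManin1991, Prop. 2 and §1] -/
theorem exists_datum_not_dvd_maninConstant_of_irreducible (W : WeierstrassCurve ℚ) [W.IsElliptic]
    [W.IsGloballyMinimal] (p : ℕ) [Fact p.Prime] (hirr : W.HasIrreducibleModPGaloisRep p)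
    {N : ℕ} [NeZero N] (f : CuspForm (Gamma0 N) 2) (hf : IsNewformOf W f)
    (hc : ∀ (W₀ : WeierstrassCurve ℚ) [W₀.IsElliptic] [W₀.IsGloballyMinimal]
      (D₀ : ModularParametrizationData W₀ N), D₀.f = f →
      (∀ z ∈ D₀.L.lattice, ∃ w ∈ periodLattice D₀.f, z = D₀.c * w) → ¬ (p : ℤ) ∣ D₀.maninConstant) :
    ∃ D : ModularParametrizationData W N, D.f = f ∧ ¬ (p : ℤ) ∣ D.maninConstant := by
  obtain ⟨D⟩ := Literature.NumberTheory.Automorphic.nonempty_modularParametrizationData_of_isNewformOf hf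
  have hDf : D.f = f := D.isNewformOf.unique hf
  subst hDf
  obtain ⟨c₁, hpc₁, hadm⟩ := exists_admissible_not_dvd_of_irreducible W p hirr D hc
  have hc₁ : c₁ ≠ 0 := by
    rintro rfl
    exact hpc₁ (dvd_zero _)
  obtain ⟨D', hf', hc'⟩ := exists_datum_of_admissible D hc₁ hadm
  exact ⟨D', hf', by rw [hc']; exact hpc₁⟩

/-- **The datum with `p ∤ c_D` at an ODD prime `p` with `p² ∤ N` and `E[p]` irreducible, from Mazur 1978,
Cor. 4.1** (the Manin constant of the `X₀(N)`-optimal curve is prime to every odd `p` with `p² ∤ N`; tree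
named fact `mazur_not_dvd_maninConstant_of_odd` = route item `PrintX6.InputMazurManinOdd`). Covers good AND
multiplicative odd `p`. CONDITIONAL on the named fact. [cite: Mazur1978, Cor. 4.1]
[cite: GreenbergVatsal2000, §3, Remark 3.4] -/
theorem exists_datum_not_dvd_maninConstant_of_mazur (hM : mazur_not_dvd_maninConstant_of_odd)
    (W : WeierstrassCurve ℚ) [W.IsElliptic] [W.IsGloballyMinimal] (p : ℕ) [Fact p.Prime] (hp2 : p ≠ 2)
    (hirr : W.HasIrreducibleModPGaloisRep p) {N : ℕ} [NeZero N] (f : CuspForm (Gamma0 N) 2)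
    (hf : IsNewformOf W f) (hpN : ¬ p ^ 2 ∣ N) :
    ∃ D : ModularParametrizationData W N, D.f = f ∧ ¬ (p : ℤ) ∣ D.maninConstant :=
  exists_datum_not_dvd_maninConstant_of_irreducible W p hirr f hf
    fun W₀ _ _ D₀ _ hopt ↦ hM W₀ D₀ hopt p Fact.out hp2 hpN

/-- **The datum with `p ∤ c_D` at a prime `p ∤ N` with `E[p]` irreducible, from Abbes–Ullmo 1996, Thm. A**
(the Manin constant of the optimal curve is prime to every `p ∤ N`; tree named fact
`abbesUllmo_not_dvd_maninConstant_of_not_dvd_level`). CONDITIONAL on the named fact.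
[cite: AbbesUllmo1996, Thm. A] [cite: GreenbergVatsal2000, §3, Remark 3.4] -/
theorem exists_datum_not_dvd_maninConstant_of_abbesUllmo
    (hAU : abbesUllmo_not_dvd_maninConstant_of_not_dvd_level)
    (W : WeierstrassCurve ℚ) [W.IsElliptic] [W.IsGloballyMinimal] (p : ℕ) [Fact p.Prime]
    (hirr : W.HasIrreducibleModPGaloisRep p) {N : ℕ} [NeZero N] (f : CuspForm (Gamma0 N) 2)
    (hf : IsNewformOf W f) (hpN : ¬ p ∣ N) :
    ∃ D : ModularParametrizationData W N, D.f = f ∧ ¬ (p : ℤ) ∣ D.maninConstant :=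
  exists_datum_not_dvd_maninConstant_of_irreducible W p hirr f hf
    fun W₀ _ _ D₀ _ hopt ↦ hAU W₀ D₀ hopt p Fact.out hpN

/-! ## §4 The shape the Kim engine consumes: datum AND period unit at a good odd prime -/

/-- **Kim's hypothesis (ii) and the period transfer, together, at a GOOD odd prime with `E[p]` irreducible,
from Mazur's corollary alone.** For `W/ℚ` globally minimal elliptic, `p` an odd prime of good reduction with
`E[p]` irreducible, and the newform `f ∈ S₂(Γ₀(N))` of `W` (any level; `p ∤ N` by
`not_dvd_level_of_hasGoodReductionAtPrime`): there is a datum `D` of `W` at level `N` with `D.f = f`,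
`p ∤ D.maninConstant` (§3, Mazur) and `Ω(W) = u · Ω⁺_{D.f}` with `u ∈ ℚ`, `|u|_p = 1`
(`exists_unit_mul_plusPeriod_of_irreducible_of_mazur`). These are exactly the binders `D`, `hc`, `hper` of
`Kim2026.rankZero_le_padicValNat_sha_of_kuriharaNumber_ne_zero[_of_localTorsionTrivial]` and of every per-pair
theorem over it. CONDITIONAL on `mazur_not_dvd_maninConstant_of_odd` (route item `PrintX6.InputMazurManinOdd`).
[cite: Mazur1978, Cor. 4.1] [cite: GreenbergVatsal2000, §3, Remark 3.4] [cite: Kim2022StructureSelmer, §1.3.5 (PDF p. 6)] -/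
theorem exists_kimDatum_of_good_of_mazur (hM : mazur_not_dvd_maninConstant_of_odd)
    (W : WeierstrassCurve ℚ) [W.IsElliptic] [W.IsGloballyMinimal] (p : ℕ) [Fact p.Prime] (hp2 : p ≠ 2)
    (hgood : W.HasGoodReductionAtPrime p) (hirr : W.HasIrreducibleModPGaloisRep p)
    {N : ℕ} [NeZero N] (f : CuspForm (Gamma0 N) 2) (hf : IsNewformOf W f) :
    ∃ D : ModularParametrizationData W N, D.f = f ∧ ¬ (p : ℤ) ∣ D.maninConstant ∧
      ∃ u : ℚ, ‖(u : ℚ_[p])‖ = 1 ∧ W.realPeriodRat = u * plusPeriod D.f := by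
  have hpN : ¬ p ^ 2 ∣ N := fun h ↦
    not_dvd_level_of_hasGoodReductionAtPrime hgood hf (dvd_trans (dvd_pow_self p two_ne_zero) h)
  obtain ⟨D, hDf, hc⟩ := exists_datum_not_dvd_maninConstant_of_mazur hM W p hp2 hirr f hf hpN
  refine ⟨D, hDf, hc, ?_⟩
  rw [hDf]
  exact exists_unit_mul_plusPeriod_of_irreducible_of_mazur hM W p hp2 hirr f hf hpN

end Summit.BirchSwinnertonDyer.BirchSwinnertonDyer.Theorems.PrintX6.KimDeficit

end
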